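import Mathlib.Combinatorics.SetFamily.HarrisKleitman
import Mathlib.Data.Finset.Sups
import Summits.CriticalPhenomena.PercolationContinuityZ3.Theorems.PercNearOneGluingNoHeavyLowerTailSahiGridPatternZProfile
import HarnessLib

/-!
# `NoHeavyLowerTail` (crux stmt-CriticalPhenomena-4575), hull-port line hp-7: MIXED Harris–Kleitman rows for complementary pairs —
# the two-colouring Hall statements EL, EL′, BUx, the six lattice rows and M_PMT of the J-BERN⁺ fibre analysis are ONE Kleitman inequality

Support file (prover `prim-hp-7`, generation 48; `--supports stmt-CriticalPhenomena-4575`).  Pure finite combinatorics, no definitions,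
no `sorry`, standard axioms; the only input is the tree lemma `SahiGridPattern.card_inter_compls_le`
(`#(𝒜 ∩ 𝒟ᶜˢ) ≤ #(𝒜 ∩ 𝒟)` for upper families `𝒜, 𝒟`: Kleitman, then Harris).

THE MATHEMATICS (memo `prim-hp-7/FROM-prim-hp-7-g48-MIXED-HARRIS.md`).  On a fibre of the J-BERN⁺ matching problem two copies of a
3-colouring are complementary subsets `ζ, ζᶜ` of the free edges, and the Hall conditions are inequalities between the counts
`N^𝒰(A,B) = #{ζ ∈ 𝒰 : ζ ∈ A, ζᶜ ∈ B}` for the five connection patterns `T, O′, E, PV, PM` of three terminals and an up-set weight `𝒰` on `ζ`.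
Generation 46 computed the cone of the 144 "weighted Harris rows" in which BOTH families are defined by the pattern of `ζ` alone, found
`EL : N^𝒰(E,PV) ≤ N^𝒰(T,PM)` (equivalently: the rigid export normal form XS of J-BERN⁺) and `M_PMT : N^𝒰(PM,T) ≤ N^𝒰(T,PM)` OUTSIDE that
cone (LP values 1/3), and listed them as open, census-clean conjectures.  They are theorems, and elementary: the point is that the Kleitman
lemma applies to EVERY upper family of configurations, including MIXED ones such as `{o ~ v in ζ} ∩ {ζᶜ ∈ P}` — a decreasing condition on
the complement is an increasing condition on `ζ`.  With `𝒜 = 𝒰 ∩ U₁ ∩ D₂ᶜˢ` and `𝒞 = U₂ ∩ D₁ᶜˢ` (both upper) one gets the abstract row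
`card_inter_upper_lower_compls_le` below:
  `#{ζ ∈ 𝒰 : ζ ∈ U₁ ∩ D₁, ζᶜ ∈ U₂ ∩ D₂} ≤ #{ζ ∈ 𝒰 : ζ ∈ U₁ ∩ U₂, ζᶜ ∈ D₁ ∩ D₂}`   (`𝒰, U₁, U₂` upper, `D₁, D₂` lower),
whose percolation readings are (with `X = {x~v}`, `{o~v}`, `O = {o~x}` increasing and `P = {o separated}`, `{x separated}`,
`{v separated}` decreasing; `E = {o~v} ∩ {x sep.}`, `PV = X ∩ {o sep.}`, `O′ = O ∩ {v sep.}`, `T = X ∩ {o~v}`, `PM = P ∩ {x sep.}`):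
  EL  `N^𝒰(E,PV) ≤ N^𝒰(T,PM)`,  EL′ `N^𝒰(O′,PV) ≤ N^𝒰(T,PM)`,  BUx `N^𝒰(PV,E) ≤ N^𝒰(T,PM)`, and in fact `N^𝒰(A,B) ≤ N^𝒰(T,PM)` for every
  ordered pair of distinct middle patterns `A ≠ B ∈ {O′,E,PV}`; and (`U₁ = D₂ = everything`) M_PMT `N^𝒰(PM,T) ≤ N^𝒰(T,PM)`
  (`card_inter_lower_compls_upper_le`).  Consequence for J-BERN⁺ (memo g46 §2.2): the export normal form XS — every export is a pure
  transfer of an edge set from copy 1 to copy 2 with copy 3 fixed — is without loss of generality.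
The genuinely non-Harris statement of that list is only the SUM `W-Λ : Σ_t N^𝒰(X_t,Y_t) ≤ N^𝒰(T,PM)` over a transversal of the three middle
pairs (at `𝒰 = ⊤` it is Gladkov's strong Harris–Kleitman inequality, tree file `…JBernStrongHK`), which stays open. [this work]
-/

namespace Summit.CriticalPhenomena.PercolationContinuityZ3.Theorems.JBern

open Finset
open scoped FinsetFamily

variable {α : Type*} [DecidableEq α] [Fintype α]

/-- The complements of a lower family form an upper family ("`ζᶜ ∈ D` is an increasing condition on `ζ`"). [this work] -/
theorem isUpperSet_compls_of_isLowerSet {𝒟 : Finset (Finset α)} (h : IsLowerSet (𝒟 : Set (Finset α))) :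
    IsUpperSet ((𝒟ᶜˢ : Finset (Finset α)) : Set (Finset α)) := by
  intro s t hst hs
  rw [Finset.mem_coe, Finset.mem_compls] at hs ⊢
  exact h (compl_le_compl hst) hs

/-- **Mixed Harris–Kleitman row (abstract EL).**  For upper families `𝒰, U₁, U₂` and lower families `D₁, D₂` of subsets of a finite set,
the sets `ζ ∈ 𝒰` with `ζ ∈ U₁ ∩ D₁` and `ζᶜ ∈ U₂ ∩ D₂` are at most as many as the sets `ζ ∈ 𝒰` with `ζ ∈ U₁ ∩ U₂` and `ζᶜ ∈ D₁ ∩ D₂`: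
`#(𝒰 ∩ U₁ ∩ D₁ ∩ (U₂ ∩ D₂)ᶜˢ) ≤ #(𝒰 ∩ U₁ ∩ U₂ ∩ (D₁ ∩ D₂)ᶜˢ)`.  Proof: `SahiGridPattern.card_inter_compls_le` for the UPPER families
`𝒜 = 𝒰 ∩ U₁ ∩ D₂ᶜˢ` and `𝒞 = U₂ ∩ D₁ᶜˢ`.  Percolation readings: EL, EL′, BUx and all six lattice rows `N^𝒰(A,B) ≤ N^𝒰(T,PM)` of the
J-BERN⁺ fibre analysis (see the module docstring). [this work] -/
theorem card_inter_upper_lower_compls_le (𝒰 U₁ U₂ D₁ D₂ : Finset (Finset α))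
    (h𝒰 : IsUpperSet (𝒰 : Set (Finset α))) (hU₁ : IsUpperSet (U₁ : Set (Finset α))) (hU₂ : IsUpperSet (U₂ : Set (Finset α)))
    (hD₁ : IsLowerSet (D₁ : Set (Finset α))) (hD₂ : IsLowerSet (D₂ : Set (Finset α))) :
    #(𝒰 ∩ U₁ ∩ D₁ ∩ (U₂ ∩ D₂)ᶜˢ) ≤ #(𝒰 ∩ U₁ ∩ U₂ ∩ (D₁ ∩ D₂)ᶜˢ) := by
  have h𝒜 : IsUpperSet ((𝒰 ∩ U₁ ∩ D₂ᶜˢ : Finset (Finset α)) : Set (Finset α)) :=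
    SahiGridPattern.isUpperSet_inter (SahiGridPattern.isUpperSet_inter h𝒰 hU₁) (isUpperSet_compls_of_isLowerSet hD₂)
  have h𝒞 : IsUpperSet ((U₂ ∩ D₁ᶜˢ : Finset (Finset α)) : Set (Finset α)) :=
    SahiGridPattern.isUpperSet_inter hU₂ (isUpperSet_compls_of_isLowerSet hD₁)
  have h := SahiGridPattern.card_inter_compls_le h𝒜 h𝒞
  have e1 : (𝒰 ∩ U₁ ∩ D₂ᶜˢ) ∩ (U₂ ∩ D₁ᶜˢ)ᶜˢ = 𝒰 ∩ U₁ ∩ D₁ ∩ (U₂ ∩ D₂)ᶜˢ := by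
    ext s
    simp only [mem_inter, compls_inter, mem_compls, compls_compls]
    tauto
  have e2 : (𝒰 ∩ U₁ ∩ D₂ᶜˢ) ∩ (U₂ ∩ D₁ᶜˢ) = 𝒰 ∩ U₁ ∩ U₂ ∩ (D₁ ∩ D₂)ᶜˢ := by
    ext s
    simp only [mem_inter, compls_inter, mem_compls]
    tauto
  rw [e1, e2] at h
  exact h

/-- **Mirror row for a (lower, upper) pair (abstract M_PMT).**  For upper families `𝒰, U` and a lower family `D`:
`#(𝒰 ∩ D ∩ Uᶜˢ) ≤ #(𝒰 ∩ U ∩ Dᶜˢ)` — among the sets `ζ ∈ 𝒰`, those with `ζ ∈ D, ζᶜ ∈ U` are at most as many as those with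
`ζ ∈ U, ζᶜ ∈ D`.  (`SahiGridPattern.card_inter_compls_le` with `𝒜 = 𝒰`, `𝒞 = U ∩ Dᶜˢ`.)  Percolation reading (`D = PM`, `U = T`):
M_PMT `N^𝒰(PM,T) ≤ N^𝒰(T,PM)`. [this work] -/
theorem card_inter_lower_compls_upper_le (𝒰 U D : Finset (Finset α))
    (h𝒰 : IsUpperSet (𝒰 : Set (Finset α))) (hU : IsUpperSet (U : Set (Finset α))) (hD : IsLowerSet (D : Set (Finset α))) :
    #(𝒰 ∩ D ∩ Uᶜˢ) ≤ #(𝒰 ∩ U ∩ Dᶜˢ) := by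
  have h𝒞 : IsUpperSet ((U ∩ Dᶜˢ : Finset (Finset α)) : Set (Finset α)) :=
    SahiGridPattern.isUpperSet_inter hU (isUpperSet_compls_of_isLowerSet hD)
  have h := SahiGridPattern.card_inter_compls_le h𝒰 h𝒞
  have e1 : 𝒰 ∩ (U ∩ Dᶜˢ)ᶜˢ = 𝒰 ∩ D ∩ Uᶜˢ := by
    ext s
    simp only [mem_inter, compls_inter, mem_compls, compls_compls]
    tauto
  have e2 : 𝒰 ∩ (U ∩ Dᶜˢ) = 𝒰 ∩ U ∩ Dᶜˢ := by
    ext s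
    simp only [mem_inter]
    tauto
  rw [e1, e2] at h
  exact h

end Summit.CriticalPhenomena.PercolationContinuityZ3.Theorems.JBern
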